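import Literature.Analysis.FluidPDE.KatoLaiTorusOperator
import HarnessLib

/-!
# Kato–Lai's operator on the torus: the local Lipschitz bound in `L²` by the `H²` distance

Analysis/FluidPDE support file for the energy-method construction of Euler flows in the
periodic cylinder (`Literature.Analysis.FluidPDE.KatoLai1984_periodicCylinderUniformExistence`;
Kato–Lai 1984, §4 (4.2)–(4.4) and §5: `A` maps bounded sets of `H^s` into `H^{s-1} ⊂ H⁰`
"weakly continuously … (note that weak convergence in `H^{s₀-1}` implies local uniform
convergence)"). For the operator `klOp` of `KatoLaiTorusOperator` and smooth real torus fields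
`U, U'` with `lat₃ U, lat₃ U' ≤ R`:

  `∫ ‖klOp U − klOp U'‖² ≤ C(L, R) · lat₂(U − U')`   (`exists_lipschitz_klOp`).

The proof is bilinear bookkeeping: the Leray part and the pressure gradient depend linearly on
the field on the period cell (`lerayPart_eqOn_of_sub`, via the `L²(cell)` projections and the
continuity of all fields), the representatives are linear, the convective term within the closed
cylinder is bilinear and is read on the torus (`cylDeriv_eq_fromTorus_convect`), cell `L²` norms
are torus `L²` norms up to `16 L` (`lintegral_cylinderCell_fromTorus_sq_le`), the Helmholtz
projection is a contraction of `L²(cell)`, and the `L²` norms of convective terms are bounded by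
the trilinear bounds of `TorusConvectionBounds`.

Everything is proved; no named fact and no `sorry` is introduced. Constants are existential.

## References

* T. Kato, C. Y. Lai, J. Funct. Anal. 56 (1984) 15–28, §4, §5. [KatoLai1984]
-/

noncomputable section

open MeasureTheory Set Function Filter Topology TopologicalSpace WithLp Finset
open scoped ContDiff NNReal ENNReal InnerProductSpace RealInnerProductSpace

namespace Literature.Analysis.FluidPDE

open FunctionSpaces FunctionSpaces.Torus UnitAddTorus

/-- Local notation for physical space `ℝ³ = EuclideanSpace ℝ (Fin 3)`. -/
local notation "ℝ³" => EuclideanSpace ℝ (Fin 3)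

/-- Local notation for the closed cylinder `{r ≤ 1}`. -/
local notation "𝕂" => closure (SetLike.coe unitCylinder : Set (EuclideanSpace ℝ (Fin 3)))

namespace PeriodicCylinder

variable {L : ℝ}

/-! ### Pointwise facts from `L²(cell)` identities -/

/-- Two fields continuous on the closed cylinder with the same cell class agree on the open cell.
[folklore] -/
theorem eqOn_cylinderCell_of_toCell_eq {F : Type*} [NormedAddCommGroup F] [NormedSpace ℝ F]
    {f g : ℝ³ → F} (hf : ContinuousOn f 𝕂) (hg : ContinuousOn g 𝕂) (h : toCell L f = toCell L g) :
    EqOn f g (cylinderCell L : Set ℝ³) := by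
  have hcell : (cylinderCell L : Set ℝ³) ⊆ 𝕂 := fun x hx => subset_closure (cylinderCell_le_unitCylinder L hx)
  have hfm : MemLp f 2 (cellMeasure L) := memLp_two_cylinderCell_of_continuousOn L hf
  have hgm : MemLp g 2 (cellMeasure L) := memLp_two_cylinderCell_of_continuousOn L hg
  have hae : f =ᵐ[cellMeasure L] g := by
    rw [toCell_eq_toLp hfm, toCell_eq_toLp hgm, MemLp.toLp_eq_toLp_iff] at h
    exact h
  exact Measure.eqOn_open_of_ae_eq hae (cylinderCell L).isOpen (hf.mono hcell) (hg.mono hcell)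

/-- **The Leray part is linear on the open cell**: for `d = u − u'`,
`P d = P u − P u'` on the cell. [folklore] -/
theorem lerayPart_eqOn_of_sub (hL : 0 < L) {u u' d : ℝ³ → ℝ³} (hu : IsSmoothPeriodic L u) (hu' : IsSmoothPeriodic L u')
    (hd : IsSmoothPeriodic L d) (h : ∀ x, d x = u x - u' x) :
    EqOn (lerayPart hL hd) (fun x => lerayPart hL hu x - lerayPart hL hu' x) (cylinderCell L : Set ℝ³) := by
  have hw := isSmoothPeriodic_lerayPart hL hu
  have hw' := isSmoothPeriodic_lerayPart hL hu'
  have hwd := isSmoothPeriodic_lerayPart hL hd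
  refine eqOn_cylinderCell_of_toCell_eq hwd.continuousOn (hw.sub hw').continuousOn ?_
  have e1 : toCell L d = toCell L u - toCell L u' := by
    rw [← toCell_sub hu.memLp hu'.memLp]
    congr 1
    funext x
    exact h x
  rw [← lerayProj_eq_lerayPart hL hd, e1, map_sub, lerayProj_eq_lerayPart hL hu, lerayProj_eq_lerayPart hL hu',
    ← toCell_sub hw.memLp hw'.memLp]

/-! ### The convective term within, read on the torus -/

/-- **`(V·∇_K) f = fromTorus ((rep(a⁻¹V)·∇) rep f)` on the open cylinder.** [folklore] -/
theorem cylDeriv_eq_fromTorus_convect (hL : 0 < L) {V : ℝ³ → ℝ³} {f : ℝ³ → ℝ³} (hV : IsSmoothPeriodic L V)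
    (hf : IsSmoothPeriodic L f) {x : ℝ³} (hx : x ∈ (unitCylinder : Set ℝ³)) :
    cylDeriv V f x = fromTorus L (Torus.convect (torusRep L fun y => boxInvLin L (V y)) (torusRep L f)) x := by
  have hxK : x ∈ 𝕂 := subset_closure hx
  have hVs : IsSmoothPeriodic L fun y => boxInvLin L (V y) :=
    ⟨(boxInvLin L).contDiff.comp_contDiffOn hV.smooth, fun y => by simp only [hV.periodic y]⟩
  rw [cylDeriv_eq_fderiv _ _ hx, (eventuallyEq_fromTorus_torusRep hL hf.periodic hx).fderiv_eq]
  have hF : IsSmooth (torusRep L f) := isSmooth_torusRep hf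
  have hlift : ContDiff ℝ ∞ (lift (torusRep L f)) := hF
  have hd : fderiv ℝ (fromTorus L (torusRep L f)) x = (fderiv ℝ (lift (torusRep L f)) (boxInv L x)).comp (boxInvLin L) := by
    have h1 : HasFDerivAt (boxInv L) (boxInvLin L) x := by
      rw [show boxInv L = fun x => boxInvLin L x + toLp 2 fun i => -((boxSide L i)⁻¹ * boxOff i) from funext (boxInv_eq L)]
      exact (boxInvLin L).hasFDerivAt.add_const _
    exact (((hlift.differentiable (by simp)) _).hasFDerivAt.comp x h1).fderiv
  rw [hd, ContinuousLinearMap.comp_apply, fderiv_lift]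
  show _ = Torus.fderiv (torusRep L f) (proj (boxInv L x)) (torusRep L (fun y => boxInvLin L (V y)) (proj (boxInv L x)))
  congr 1
  exact (fromTorus_torusRep_of_mem_K hL hVs.periodic hxK).symm

/-- **Cell `L²` norms are torus `L²` norms up to `16 L`.** [folklore] -/
theorem lintegral_cylinderCell_fromTorus_sq_le (hL : 0 < L) {Φ : UnitAddTorus (Fin 3) → ℝ³} (hΦ : IsSmooth Φ) :
    ∫⁻ x in (cylinderCell L : Set ℝ³), ‖fromTorus L Φ x‖ₑ ^ 2 ≤ ENNReal.ofReal (16 * L) * ∫⁻ ξ, ‖Φ ξ‖ₑ ^ 2 := by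
  have key := lintegral_iterDirDeriv_fromTorus_sq hL hΦ []
  simp only [boxScale_nil, one_pow, ENNReal.ofReal_one, one_mul, Torus.wordVecs_nil, iterDirDeriv_nil,
    Torus.wordDeriv_nil] at key
  rw [← key]
  exact lintegral_mono_set (cylinderCell_subset_openBox L)

/-- The real form: `∫_cell ‖fromTorus Φ‖² ≤ 16 L ∫ ‖Φ‖²`. [folklore] -/
theorem integral_cylinderCell_fromTorus_sq_le (hL : 0 < L) {Φ : UnitAddTorus (Fin 3) → ℝ³} (hΦ : IsSmooth Φ) :
    ∫ x in (cylinderCell L : Set ℝ³), ‖fromTorus L Φ x‖ ^ 2 ≤ 16 * L * ∫ ξ, ‖Φ ξ‖ ^ 2 := by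
  have h1 := lintegral_cylinderCell_fromTorus_sq_le hL hΦ
  rw [← ofReal_integral_norm_sq hΦ, ← ENNReal.ofReal_mul (by positivity)] at h1
  have hcont : Continuous (fromTorus L Φ) := (contDiff_fromTorus L hΦ).continuous
  have hint : IntegrableOn (fun x => ‖fromTorus L Φ x‖ ^ 2) (cylinderCell L : Set ℝ³) volume := by
    refine (integrableOn_cylinderCell_of_continuousOn_K L ((hcont.norm.pow 2).continuousOn)).congr_fun ?_
      (cylinderCell L).isOpen.measurableSet
    exact fun _ _ => rfl
  have h2 : ENNReal.ofReal (∫ x in (cylinderCell L : Set ℝ³), ‖fromTorus L Φ x‖ ^ 2) =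
      ∫⁻ x in (cylinderCell L : Set ℝ³), ‖fromTorus L Φ x‖ₑ ^ 2 := by
    rw [ofReal_integral_eq_lintegral_ofReal hint (ae_of_all _ fun _ => sq_nonneg _)]
    exact lintegral_congr fun x => (enorm_sq_eq_ofReal _).symm
  rw [← h2] at h1
  exact (ENNReal.ofReal_le_ofReal_iff (by positivity)).1 h1

/-! ### `L²` norms of convective terms on the torus -/

/-- From a trilinear bound to an `L²` bound: if `|∫⟪c, z⟫| ≤ M √(∫‖z‖²)` for `z = c` then
`∫ ‖c‖² ≤ M²`. [folklore] -/
theorem integral_sq_le_of_self_pairing {c : UnitAddTorus (Fin 3) → ℝ³} {M : ℝ} (hM : 0 ≤ M)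
    (h : |∫ ξ, ⟪c ξ, c ξ⟫| ≤ M * Real.sqrt (∫ ξ, ‖c ξ‖ ^ 2)) : ∫ ξ, ‖c ξ‖ ^ 2 ≤ M ^ 2 := by
  have hI : ∫ ξ, ⟪c ξ, c ξ⟫ = ∫ ξ, ‖c ξ‖ ^ 2 := integral_congr_ae (ae_of_all _ fun ξ => real_inner_self_eq_norm_sq _)
  have hI0 : 0 ≤ ∫ ξ, ‖c ξ‖ ^ 2 := integral_nonneg fun _ => sq_nonneg _
  rw [hI, abs_of_nonneg hI0] at h
  -- `I ≤ M √I` gives `√I ≤ M`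
  have hs : Real.sqrt (∫ ξ, ‖c ξ‖ ^ 2) ≤ M := by
    by_contra hlt
    rw [not_le] at hlt
    have hpos : 0 < Real.sqrt (∫ ξ, ‖c ξ‖ ^ 2) := hM.trans_lt hlt
    have : Real.sqrt (∫ ξ, ‖c ξ‖ ^ 2) * Real.sqrt (∫ ξ, ‖c ξ‖ ^ 2) ≤ M * Real.sqrt (∫ ξ, ‖c ξ‖ ^ 2) := by
      rw [Real.mul_self_sqrt hI0]; exact h
    have := le_of_mul_le_mul_right this hpos
    linarith
  calc ∫ ξ, ‖c ξ‖ ^ 2 = Real.sqrt (∫ ξ, ‖c ξ‖ ^ 2) ^ 2 := (Real.sq_sqrt hI0).symm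
    _ ≤ M ^ 2 := pow_le_pow_left₀ (Real.sqrt_nonneg _) hs 2

/-- **`∫ ‖(A·∇)B‖² ≤ C lat₂(A) lat₁(B)`.** [folklore] -/
theorem exists_integral_convect_sq_le_sup_left : ∃ C : ℝ, 0 ≤ C ∧
    ∀ (A B : UnitAddTorus (Fin 3) → ℝ³), IsSmooth A → IsSmooth B →
      ∫ ξ, ‖Torus.convect A B ξ‖ ^ 2 ≤ C * Torus.latNormSq 2 A * Torus.latNormSq 1 B := by
  obtain ⟨C, hC0, hC⟩ := Torus.exists_trilinear_sup_left (d := Fin 3) (by simp)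
  refine ⟨C ^ 2, by positivity, fun A B hA hB => ?_⟩
  have hc := hA.convect hB
  have h := hC A B (Torus.convect A B) hA hB hc
  have h2 := integral_sq_le_of_self_pairing (by have := Torus.latNormSq_nonneg 2 A; positivity) h
  calc ∫ ξ, ‖Torus.convect A B ξ‖ ^ 2 ≤ (C * Real.sqrt (Torus.latNormSq 2 A) * Real.sqrt (Torus.latNormSq 1 B)) ^ 2 := h2
    _ = C ^ 2 * Torus.latNormSq 2 A * Torus.latNormSq 1 B := by
        rw [mul_pow, mul_pow, Real.sq_sqrt (Torus.latNormSq_nonneg 2 A), Real.sq_sqrt (Torus.latNormSq_nonneg 1 B)]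

/-- **`∫ ‖(A·∇)B‖² ≤ C lat₁(A) lat₂(B)`.** [folklore] -/
theorem exists_integral_convect_sq_le_L4 : ∃ C : ℝ, 0 ≤ C ∧
    ∀ (A B : UnitAddTorus (Fin 3) → ℝ³), IsSmooth A → IsSmooth B →
      ∫ ξ, ‖Torus.convect A B ξ‖ ^ 2 ≤ C * Torus.latNormSq 1 A * Torus.latNormSq 2 B := by
  obtain ⟨C, hC0, hC⟩ := Torus.exists_trilinear_L4 (d := Fin 3) (by simp)
  refine ⟨C ^ 2, by positivity, fun A B hA hB => ?_⟩
  have hc := hA.convect hB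
  have h := hC A B (Torus.convect A B) hA hB hc
  have h2 := integral_sq_le_of_self_pairing (by have := Torus.latNormSq_nonneg 1 A; positivity) h
  calc ∫ ξ, ‖Torus.convect A B ξ‖ ^ 2 ≤ (C * Real.sqrt (Torus.latNormSq 1 A) * Real.sqrt (Torus.latNormSq 2 B)) ^ 2 := h2
    _ = C ^ 2 * Torus.latNormSq 1 A * Torus.latNormSq 2 B := by
        rw [mul_pow, mul_pow, Real.sq_sqrt (Torus.latNormSq_nonneg 1 A), Real.sq_sqrt (Torus.latNormSq_nonneg 2 B)]

/-! ### Linearity bookkeeping -/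

/-- The representative of a difference. [folklore] -/
theorem torusRep_sub {F : Type*} [NormedAddCommGroup F] [NormedSpace ℝ F] (L : ℝ) (f g : ℝ³ → F) :
    torusRep L (fun x => f x - g x) = fun ξ => torusRep L f ξ - torusRep L g ξ := by
  have e : (fun x => f x - g x) = f + (-1 : ℝ) • g := by funext x; simp [sub_eq_add_neg]
  rw [e, torusRep_add, torusRep_smul]
  funext ξ
  simp [sub_eq_add_neg]

/-- The convective derivative on the torus is bilinear:
`(W·∇)U − (W'·∇)U' = ((W−W')·∇)U + (W'·∇)(U−U')` for smooth `U, U'`. [folklore] -/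
theorem convect_sub_convect {W W' U U' : UnitAddTorus (Fin 3) → ℝ³} (hU : IsSmooth U) (hU' : IsSmooth U') (ξ : UnitAddTorus (Fin 3)) :
    Torus.convect W U ξ - Torus.convect W' U' ξ =
      Torus.convect (fun η => W η - W' η) U ξ + Torus.convect W' (fun η => U η - U' η) ξ := by
  simp only [Torus.convect, Torus.fderiv]
  have hd : liftAt (fun η => U η - U' η) ξ = fun v => liftAt U ξ v - liftAt U' ξ v := rfl
  have h1 : DifferentiableAt ℝ (liftAt U ξ) 0 :=
    (((hU.isContDiff (n := 1) (by simp)).liftAt ξ).differentiable one_ne_zero).differentiableAt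
  have h2 : DifferentiableAt ℝ (liftAt U' ξ) 0 :=
    (((hU'.isContDiff (n := 1) (by simp)).liftAt ξ).differentiable one_ne_zero).differentiableAt
  rw [hd, fderiv_fun_sub h1 h2]
  simp only [FunLike.coe_sub, Pi.sub_apply, map_sub]
  abel

/-- The convective term within is bilinear on the closed cylinder. [folklore] -/
theorem cylDeriv_sub_cylDeriv {w w' : ℝ³ → ℝ³} (hw : ContDiffOn ℝ ∞ w 𝕂) (hw' : ContDiffOn ℝ ∞ w' 𝕂) {x : ℝ³} (hx : x ∈ 𝕂) :
    cylDeriv w w x - cylDeriv w' w' x = cylDeriv (fun y => w y - w' y) w x + cylDeriv w' (fun y => w y - w' y) x := by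
  rw [cylDeriv_field_sub, cylDeriv_sub hw hw' hx]
  abel

/-- `lat₀(torusRep h) ≤ C ∫_cell ‖h‖²` for `h` smooth periodic. [folklore] -/
theorem exists_latNormSq_zero_torusRep_le (hL : 0 < L) : ∃ C : ℝ, 0 ≤ C ∧
    ∀ (h : ℝ³ → ℝ³), IsSmoothPeriodic L h →
      Torus.latNormSq 0 (torusRep L h) ≤ C * ∫ x in (cylinderCell L : Set ℝ³), ‖h x‖ ^ 2 := by
  obtain ⟨C, hC0, hC⟩ := exists_latticeEnergy_toTorus_cylExtend_le hL 0
  refine ⟨C, hC0, fun h hh => ?_⟩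
  have key := hC h hh.smooth hh.periodic
  have hcellE : cellEnergy L 0 h = ∫⁻ x in (cylinderCell L : Set ℝ³), ‖h x‖ₑ ^ 2 := by
    rw [cellEnergy, Finset.sum_range_one]
    refine lintegral_congr fun x => ?_
    rw [← ofReal_norm, norm_iteratedFDeriv_zero, ofReal_norm]
  have hcont : ContinuousOn h 𝕂 := hh.continuousOn
  have hint := integral_norm_sq_eq_cellL2_sq L hcont
  have hint' : ∫⁻ x in (cylinderCell L : Set ℝ³), ‖h x‖ₑ ^ 2 = ENNReal.ofReal (∫ x in (cylinderCell L : Set ℝ³), ‖h x‖ ^ 2) := by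
    have hio : IntegrableOn (fun x => ‖h x‖ ^ 2) (cylinderCell L : Set ℝ³) volume :=
      integrableOn_cylinderCell_of_continuousOn_K L (hcont.norm.pow 2)
    rw [ofReal_integral_eq_lintegral_ofReal hio (ae_of_all _ fun _ => sq_nonneg _)]
    exact lintegral_congr fun x => enorm_sq_eq_ofReal _
  rw [hcellE, hint', ← ENNReal.ofReal_mul hC0] at key
  have hI0 : 0 ≤ ∫ x in (cylinderCell L : Set ℝ³), ‖h x‖ ^ 2 := integral_nonneg fun _ => sq_nonneg _
  exact (ENNReal.ofReal_le_ofReal_iff (by positivity)).1 key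

/-! ### The Lipschitz bound, in three lemmas -/

section Lip

variable (hL : 0 < L)

/-- `‖p + q‖² ≤ 2 (‖p‖² + ‖q‖²)`. [folklore] -/
theorem norm_add_sq_le_two_mul (p q : ℝ³) : ‖p + q‖ ^ 2 ≤ 2 * (‖p‖ ^ 2 + ‖q‖ ^ 2) := by
  calc ‖p + q‖ ^ 2 ≤ (‖p‖ + ‖q‖) ^ 2 := pow_le_pow_left₀ (norm_nonneg _) (norm_add_le p q) 2
    _ ≤ 2 * (‖p‖ ^ 2 + ‖q‖ ^ 2) := by nlinarith [sq_nonneg (‖p‖ - ‖q‖)]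

/-- `‖p + q − r‖² ≤ 4 (‖p‖² + ‖q‖² + ‖r‖²)`. [folklore] -/
theorem norm_add_sub_sq_le_four (p q r : ℝ³) : ‖p + q - r‖ ^ 2 ≤ 4 * (‖p‖ ^ 2 + ‖q‖ ^ 2 + ‖r‖ ^ 2) := by
  have h1 : ‖p + q - r‖ ^ 2 ≤ 2 * (‖p + q‖ ^ 2 + ‖r‖ ^ 2) := by
    have := norm_add_sq_le_two_mul (p + q) (-r)
    rwa [← sub_eq_add_neg, norm_neg] at this
  have h2 := norm_add_sq_le_two_mul p q
  nlinarith [h1, h2, sq_nonneg ‖r‖]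

/-- **Step 1: the Leray parts of `U` and `U'` differ by `O(lat₁(U − U'))`**, for the
representatives of `w − w'` and of `a⁻¹(w − w')`. [folklore] -/
theorem exists_latNormSq_one_lerayPart_sub_le : ∃ K : ℝ, 0 ≤ K ∧
    ∀ (U U' : UnitAddTorus (Fin 3) → ℝ³) (hU : IsSmooth U) (hU' : IsSmooth U'),
      Torus.latNormSq 1 (torusRep L fun x => lerayPart hL (isSmoothPeriodic_fromTorus hL.ne' hU) x -
          lerayPart hL (isSmoothPeriodic_fromTorus hL.ne' hU') x) ≤ K * Torus.latNormSq 1 (fun ξ => U ξ - U' ξ) ∧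
      Torus.latNormSq 1 (fun ξ => transportRep L hL hU ξ - transportRep L hL hU' ξ) ≤ K * Torus.latNormSq 1 (fun ξ => U ξ - U' ξ) := by
  obtain ⟨Cr1, hCr10, hCr1⟩ := exists_latNormSq_torusRep_le hL 1
  obtain ⟨CP0, hCP0⟩ := exists_leray_bound hL 0
  obtain ⟨CE1, hCE10, hCE1⟩ := exists_toReal_eSobolevDomainNorm_fromTorus_sq_le hL 1
  refine ⟨Cr1 * ((1 + ‖boxInvLin L‖) * (1 + CP0)) ^ 2 * CE1, by positivity, fun U U' hU hU' => ?_⟩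
  set D : UnitAddTorus (Fin 3) → ℝ³ := fun ξ => U ξ - U' ξ with hDdef
  have hD : IsSmooth D := hU.sub hU'
  have hu := isSmoothPeriodic_fromTorus hL.ne' hU
  have hu' := isSmoothPeriodic_fromTorus hL.ne' hU'
  have hd := isSmoothPeriodic_fromTorus hL.ne' hD
  set w := lerayPart hL hu with hwdef
  set w' := lerayPart hL hu' with hw'def
  have hw := isSmoothPeriodic_lerayPart hL hu
  have hw' := isSmoothPeriodic_lerayPart hL hu'
  have hwd := isSmoothPeriodic_lerayPart hL hd
  have hww' : IsSmoothPeriodic L fun x => w x - w' x := hw.sub hw'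
  have hEq : EqOn (lerayPart hL hd) (fun x => w x - w' x) (cylinderCell L : Set ℝ³) :=
    lerayPart_eqOn_of_sub hL hu hu' hd fun x => rfl
  have hcell : (cylinderCell L : Set ℝ³) ⊆ 𝕂 := fun x hx => subset_closure (cylinderCell_le_unitCylinder L hx)
  have hfinD : eSobolevDomainNorm 1 2 (cylinderCell L) volume (fromTorus L D) < ⊤ :=
    eSobolevDomainNorm_lt_top_of_isSmoothPeriodic L 1 hd.smooth
  set ED := (eSobolevDomainNorm 1 2 (cylinderCell L) volume (fromTorus L D)).toReal with hED
  have hED0 : 0 ≤ ED := ENNReal.toReal_nonneg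
  have hE1 : (eSobolevDomainNorm 1 2 (cylinderCell L) volume (fun x => w x - w' x)).toReal ≤ (1 + CP0) * ED := by
    have hcongr : eSobolevDomainNorm 1 2 (cylinderCell L) volume (fun x => w x - w' x) =
        eSobolevDomainNorm 1 2 (cylinderCell L) volume (lerayPart hL hd) :=
      SobolevApprox.eSobolevDomainNorm_congr (Ω := cylinderCell L) (p := 2) (μ := volume) fun x hx => (hEq hx).symm
    rw [hcongr]
    have := ENNReal.toReal_mono (ENNReal.mul_ne_top ENNReal.coe_ne_top hfinD.ne) (hCP0 hd).2
    rw [ENNReal.toReal_mul, ENNReal.coe_toReal, NNReal.coe_add, NNReal.coe_one] at this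
    exact this
  have hEDlat : ED ^ 2 ≤ CE1 * Torus.latNormSq 1 D := hCE1 D hD
  have hwper : IsAxiallyPeriodic L w := hw.periodic
  have hw'per : IsAxiallyPeriodic L w' := hw'.periodic
  have hMww' : IsSmoothPeriodic L fun x => boxInvLin L (w x - w' x) :=
    ⟨(boxInvLin L).contDiff.comp_contDiffOn hww'.smooth, fun x => by
      show boxInvLin L (w (x + _) - w' (x + _)) = _
      rw [hwper x, hw'per x]⟩
  have hE1M : (eSobolevDomainNorm 1 2 (cylinderCell L) volume (fun x => boxInvLin L (w x - w' x))).toReal ≤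
      ‖boxInvLin L‖ * ((1 + CP0) * ED) := by
    have hfin : eSobolevDomainNorm 1 2 (cylinderCell L) volume (fun x => w x - w' x) < ⊤ :=
      eSobolevDomainNorm_lt_top_of_isSmoothPeriodic L 1 hww'.smooth
    have h1 := eSobolevDomainNorm_clm_comp_le (Ω := cylinderCell L) (p := 2) (μ := volume) (boxInvLin L) 1 (hww'.smooth.mono hcell)
    have := ENNReal.toReal_mono (ENNReal.mul_ne_top ENNReal.coe_ne_top hfin.ne) h1
    rw [ENNReal.toReal_mul, ENNReal.coe_toReal, coe_nnnorm] at this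
    exact this.trans (mul_le_mul_of_nonneg_left hE1 (norm_nonneg _))
  -- both representatives: cell norm `≤ (1 + ‖M‖)(1 + CP0) ED`
  have hB : ∀ {h : ℝ³ → ℝ³}, IsSmoothPeriodic L h →
      (eSobolevDomainNorm 1 2 (cylinderCell L) volume h).toReal ≤ (1 + ‖boxInvLin L‖) * (1 + CP0) * ED →
      Torus.latNormSq 1 (torusRep L h) ≤ Cr1 * ((1 + ‖boxInvLin L‖) * (1 + CP0)) ^ 2 * CE1 * Torus.latNormSq 1 D := by
    intro h hh hle
    calc Torus.latNormSq 1 (torusRep L h) ≤ Cr1 * (eSobolevDomainNorm 1 2 (cylinderCell L) volume h).toReal ^ 2 := hCr1 _ hh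
      _ ≤ Cr1 * ((1 + ‖boxInvLin L‖) * (1 + CP0) * ED) ^ 2 := mul_le_mul_of_nonneg_left (pow_le_pow_left₀ ENNReal.toReal_nonneg hle 2) hCr10
      _ = Cr1 * ((1 + ‖boxInvLin L‖) * (1 + CP0)) ^ 2 * ED ^ 2 := by ring
      _ ≤ Cr1 * ((1 + ‖boxInvLin L‖) * (1 + CP0)) ^ 2 * (CE1 * Torus.latNormSq 1 D) := mul_le_mul_of_nonneg_left hEDlat (by positivity)
      _ = _ := by ring
  have hP0 : (0 : ℝ) ≤ CP0 := CP0.2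
  constructor
  · refine hB hww' (hE1.trans ?_)
    have : 0 ≤ (1 + CP0) * ED := by positivity
    nlinarith [norm_nonneg (boxInvLin L)]
  · have hWsub : (fun ξ => transportRep L hL hU ξ - transportRep L hL hU' ξ) = torusRep L fun x => boxInvLin L (w x - w' x) := by
      rw [transportRep, transportRep, ← torusRep_sub]
      congr 1
      funext x
      simp only [map_sub, hwdef, hw'def]
    rw [hWsub]
    refine hB hMww' (hE1M.trans ?_)
    have : 0 ≤ (1 + CP0) * ED := by positivity
    nlinarith [norm_nonneg (boxInvLin L)]

/-- **Step 2: the representative of the Leray part at level `2`**: `lat₂(rep w) ≤ K lat₂(U)`. [folklore] -/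
theorem exists_latNormSq_two_rep_lerayPart_le : ∃ K : ℝ, 0 ≤ K ∧
    ∀ (U : UnitAddTorus (Fin 3) → ℝ³) (hU : IsSmooth U),
      Torus.latNormSq 2 (torusRep L (lerayPart hL (isSmoothPeriodic_fromTorus hL.ne' hU))) ≤ K * Torus.latNormSq 2 U := by
  obtain ⟨Cr2, hCr20, hCr2⟩ := exists_latNormSq_torusRep_le hL 2
  obtain ⟨CP1, hCP1⟩ := exists_leray_bound hL 1
  obtain ⟨CE2, hCE20, hCE2⟩ := exists_toReal_eSobolevDomainNorm_fromTorus_sq_le hL 2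
  refine ⟨Cr2 * (1 + CP1 : ℝ) ^ 2 * CE2, by positivity, fun U hU => ?_⟩
  have hu := isSmoothPeriodic_fromTorus hL.ne' hU
  have hw := isSmoothPeriodic_lerayPart hL hu
  have hfin2 : eSobolevDomainNorm 2 2 (cylinderCell L) volume (fromTorus L U) < ⊤ :=
    eSobolevDomainNorm_lt_top_of_isSmoothPeriodic L 2 hu.smooth
  have hE2 : (eSobolevDomainNorm 2 2 (cylinderCell L) volume (lerayPart hL hu)).toReal ≤
      (1 + CP1) * (eSobolevDomainNorm 2 2 (cylinderCell L) volume (fromTorus L U)).toReal := by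
    have := ENNReal.toReal_mono (ENNReal.mul_ne_top ENNReal.coe_ne_top hfin2.ne) (hCP1 hu).2
    rw [ENNReal.toReal_mul, ENNReal.coe_toReal, NNReal.coe_add, NNReal.coe_one] at this
    exact this
  have hEU := hCE2 U hU
  calc Torus.latNormSq 2 (torusRep L (lerayPart hL hu)) ≤ Cr2 * (eSobolevDomainNorm 2 2 (cylinderCell L) volume (lerayPart hL hu)).toReal ^ 2 :=
        hCr2 _ hw
    _ ≤ Cr2 * ((1 + CP1) * (eSobolevDomainNorm 2 2 (cylinderCell L) volume (fromTorus L U)).toReal) ^ 2 :=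
        mul_le_mul_of_nonneg_left (pow_le_pow_left₀ ENNReal.toReal_nonneg hE2 2) hCr20
    _ = Cr2 * (1 + CP1 : ℝ) ^ 2 * (eSobolevDomainNorm 2 2 (cylinderCell L) volume (fromTorus L U)).toReal ^ 2 := by ring
    _ ≤ Cr2 * (1 + CP1 : ℝ) ^ 2 * (CE2 * Torus.latNormSq 2 U) := mul_le_mul_of_nonneg_left hEU (by positivity)
    _ = _ := by ring

/-- **Step 3: the pressure fields of `U` and `U'` differ in `L²` by `O(√R · √lat₂(U − U'))`** on
`lat₃`-balls of radius `R`. [folklore] -/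
theorem exists_integral_pressureRep_sub_sq_le (R : ℝ) : ∃ K : ℝ, 0 ≤ K ∧
    ∀ (U U' : UnitAddTorus (Fin 3) → ℝ³) (hU : IsSmooth U) (hU' : IsSmooth U'),
      Torus.latNormSq 3 U ≤ R → Torus.latNormSq 3 U' ≤ R →
      ∫ ξ, ‖pressureRep L hL hU ξ - pressureRep L hL hU' ξ‖ ^ 2 ≤ K * Torus.latNormSq 2 (fun ξ => U ξ - U' ξ) := by
  obtain ⟨Csl, hCsl0, hCsl⟩ := exists_integral_convect_sq_le_sup_left
  obtain ⟨CL4, hCL40, hCL4⟩ := exists_integral_convect_sq_le_L4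
  obtain ⟨CW2, hCW20, hCW2⟩ := exists_latNormSq_transportRep_le hL (m := 2) (by norm_num)
  obtain ⟨K₁, hK₁0, hK₁⟩ := exists_latNormSq_one_lerayPart_sub_le hL
  obtain ⟨K₂, hK₂0, hK₂⟩ := exists_latNormSq_two_rep_lerayPart_le hL
  obtain ⟨C0, hC00, hC0⟩ := exists_latNormSq_zero_torusRep_le hL
  refine ⟨C0 * (2 * (16 * L) * (CL4 * K₁ * (K₂ * |R|) + Csl * (CW2 * |R|) * K₁)), by positivity,
    fun U U' hU hU' h3 h3' => ?_⟩
  have hR0 : 0 ≤ R := (Torus.latNormSq_nonneg 3 U).trans h3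
  have habs : |R| = R := abs_of_nonneg hR0
  set D : UnitAddTorus (Fin 3) → ℝ³ := fun ξ => U ξ - U' ξ with hDdef
  have hD : IsSmooth D := hU.sub hU'
  have hu := isSmoothPeriodic_fromTorus hL.ne' hU
  have hu' := isSmoothPeriodic_fromTorus hL.ne' hU'
  set w := lerayPart hL hu with hwdef
  set w' := lerayPart hL hu' with hw'def
  have hw := isSmoothPeriodic_lerayPart hL hu
  have hw' := isSmoothPeriodic_lerayPart hL hu'
  have hww' : IsSmoothPeriodic L fun x => w x - w' x := hw.sub hw'
  have l1 := Torus.latNormSq_nonneg 1 D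
  have l2 := Torus.latNormSq_nonneg 2 D
  have hl12 : Torus.latNormSq 1 D ≤ Torus.latNormSq 2 D := Torus.latNormSq_mono hD (by norm_num)
  obtain ⟨hrep1, hW1⟩ := hK₁ U U' hU hU'
  have hrep2 : Torus.latNormSq 2 (torusRep L w) ≤ K₂ * R :=
    (hK₂ U hU).trans (mul_le_mul_of_nonneg_left ((Torus.latNormSq_mono hU (by norm_num)).trans h3) hK₂0)
  have hW'2 : Torus.latNormSq 2 (transportRep L hL hU') ≤ CW2 * R :=
    (hCW2 U' hU').trans (mul_le_mul_of_nonneg_left ((Torus.latNormSq_mono hU' (by norm_num)).trans h3') hCW20)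
  -- the fields of the pressure problem
  set v := convTerm hL hu with hvdef
  set v' := convTerm hL hu' with hv'def
  have hvs := isSmoothPeriodic_convTerm hL hu
  have hv's := isSmoothPeriodic_convTerm hL hu'
  have hπ := isSmoothPeriodic_pressureGrad hL hu
  have hπ' := isSmoothPeriodic_pressureGrad hL hu'
  have hππ' : IsSmoothPeriodic L fun x => pressureGrad hL hu x - pressureGrad hL hu' x := hπ.sub hπ'
  have hGsub : (fun ξ => pressureRep L hL hU ξ - pressureRep L hL hU' ξ) = torusRep L fun x => pressureGrad hL hu x - pressureGrad hL hu' x := by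
    rw [pressureRep, pressureRep, torusRep_sub]
  have hlat0 : ∫ ξ, ‖pressureRep L hL hU ξ - pressureRep L hL hU' ξ‖ ^ 2 =
      Torus.latNormSq 0 (torusRep L fun x => pressureGrad hL hu x - pressureGrad hL hu' x) := by
    rw [Torus.latNormSq_zero (isSmooth_torusRep hππ'), ← hGsub]
  -- `∫_cell |∇π − ∇π'|² ≤ ∫_cell |v − v'|²`
  have hcellπ : ∫ x in (cylinderCell L : Set ℝ³), ‖pressureGrad hL hu x - pressureGrad hL hu' x‖ ^ 2 ≤
      ∫ x in (cylinderCell L : Set ℝ³), ‖v x - v' x‖ ^ 2 := by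
    have e1 : toCell L (fun x => pressureGrad hL hu x - pressureGrad hL hu' x) = helmholtzProj L (toCell L fun x => v x - v' x) := by
      rw [toCell_sub hπ.memLp hπ'.memLp, toCell_sub hvs.memLp hv's.memLp, map_sub]
      have e2 : toCell L (pressureGrad hL hu) = helmholtzProj L (toCell L v) := ((lerayPot_spec hL hvs).2.1).symm
      have e3 : toCell L (pressureGrad hL hu') = helmholtzProj L (toCell L v') := ((lerayPot_spec hL hv's).2.1).symm
      rw [e2, e3]
    have hn : ‖toCell L (fun x => pressureGrad hL hu x - pressureGrad hL hu' x)‖ ≤ ‖toCell L fun x => v x - v' x‖ := by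
      rw [e1]; exact norm_helmholtzProj_le _
    rw [integral_norm_sq_eq_cellL2_sq L hππ'.continuousOn, integral_norm_sq_eq_cellL2_sq L (hvs.sub hv's).continuousOn,
      ← norm_toCell_eq_cellL2 hππ'.continuousOn, ← norm_toCell_eq_cellL2 (hvs.sub hv's).continuousOn]
    exact pow_le_pow_left₀ (norm_nonneg _) hn 2
  -- `v − v'` on the cell through the torus
  set c₁ : UnitAddTorus (Fin 3) → ℝ³ := Torus.convect (torusRep L fun y => boxInvLin L (w y - w' y)) (torusRep L w) with hc₁
  set c₂ : UnitAddTorus (Fin 3) → ℝ³ := Torus.convect (torusRep L fun y => boxInvLin L (w' y)) (torusRep L fun y => w y - w' y) with hc₂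
  have hwper : IsAxiallyPeriodic L w := hw.periodic
  have hw'per : IsAxiallyPeriodic L w' := hw'.periodic
  have hMww' : IsSmoothPeriodic L fun y => boxInvLin L (w y - w' y) :=
    ⟨(boxInvLin L).contDiff.comp_contDiffOn hww'.smooth, fun x => by
      show boxInvLin L (w (x + _) - w' (x + _)) = _
      rw [hwper x, hw'per x]⟩
  have hMw' : IsSmoothPeriodic L fun y => boxInvLin L (w' y) :=
    ⟨(boxInvLin L).contDiff.comp_contDiffOn hw'.smooth, fun x => by
      show boxInvLin L (w' (x + _)) = _
      rw [hw'per x]⟩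
  have hc₁s : IsSmooth c₁ := (isSmooth_torusRep hMww').convect (isSmooth_torusRep hw)
  have hc₂s : IsSmooth c₂ := (isSmooth_torusRep hMw').convect (isSmooth_torusRep hww')
  have hvv' : ∀ x ∈ (cylinderCell L : Set ℝ³), v x - v' x = fromTorus L c₁ x + fromTorus L c₂ x := by
    intro x hx
    have hxU : x ∈ (unitCylinder : Set ℝ³) := cylinderCell_le_unitCylinder L hx
    rw [hvdef, hv'def, convTerm, convTerm, cylDeriv_sub_cylDeriv hw.smooth hw'.smooth (subset_closure hxU),
      cylDeriv_eq_fromTorus_convect hL hww' hw hxU, cylDeriv_eq_fromTorus_convect hL hw' hww' hxU]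
  have hcellv : ∫ x in (cylinderCell L : Set ℝ³), ‖v x - v' x‖ ^ 2 ≤ 2 * (16 * L) * ((∫ ξ, ‖c₁ ξ‖ ^ 2) + ∫ ξ, ‖c₂ ξ‖ ^ 2) := by
    have hc₁c : Continuous (fromTorus L c₁) := (contDiff_fromTorus L hc₁s).continuous
    have hc₂c : Continuous (fromTorus L c₂) := (contDiff_fromTorus L hc₂s).continuous
    have hi₁ : IntegrableOn (fun x => ‖fromTorus L c₁ x‖ ^ 2) (cylinderCell L : Set ℝ³) volume :=
      integrableOn_cylinderCell_of_continuousOn_K L ((hc₁c.norm.pow 2).continuousOn)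
    have hi₂ : IntegrableOn (fun x => ‖fromTorus L c₂ x‖ ^ 2) (cylinderCell L : Set ℝ³) volume :=
      integrableOn_cylinderCell_of_continuousOn_K L ((hc₂c.norm.pow 2).continuousOn)
    have hI₁ := integral_cylinderCell_fromTorus_sq_le hL hc₁s
    have hI₂ := integral_cylinderCell_fromTorus_sq_le hL hc₂s
    calc ∫ x in (cylinderCell L : Set ℝ³), ‖v x - v' x‖ ^ 2
        = ∫ x in (cylinderCell L : Set ℝ³), ‖fromTorus L c₁ x + fromTorus L c₂ x‖ ^ 2 :=
          setIntegral_congr_fun (cylinderCell L).isOpen.measurableSet fun x hx => by rw [hvv' x hx]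
      _ ≤ ∫ x in (cylinderCell L : Set ℝ³), 2 * (‖fromTorus L c₁ x‖ ^ 2 + ‖fromTorus L c₂ x‖ ^ 2) :=
          integral_mono_of_nonneg (ae_of_all _ fun x => sq_nonneg _) ((hi₁.add hi₂).const_mul 2)
            (ae_of_all _ fun x => norm_add_sq_le_two_mul _ _)
      _ = 2 * ((∫ x in (cylinderCell L : Set ℝ³), ‖fromTorus L c₁ x‖ ^ 2) + ∫ x in (cylinderCell L : Set ℝ³), ‖fromTorus L c₂ x‖ ^ 2) := by
          rw [integral_const_mul, integral_add hi₁ hi₂]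
      _ ≤ 2 * ((16 * L * ∫ ξ, ‖c₁ ξ‖ ^ 2) + 16 * L * ∫ ξ, ‖c₂ ξ‖ ^ 2) :=
          mul_le_mul_of_nonneg_left (add_le_add hI₁ hI₂) (by norm_num)
      _ = _ := by ring
  have hWsub : (fun ξ => transportRep L hL hU ξ - transportRep L hL hU' ξ) = torusRep L fun x => boxInvLin L (w x - w' x) := by
    rw [transportRep, transportRep, ← torusRep_sub]
    congr 1
    funext x
    simp only [map_sub, hwdef, hw'def]
  have hrepMdiff : Torus.latNormSq 1 (torusRep L fun y => boxInvLin L (w y - w' y)) ≤ K₁ * Torus.latNormSq 1 D := by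
    rw [← hWsub]; exact hW1
  have hc₁b : ∫ ξ, ‖c₁ ξ‖ ^ 2 ≤ CL4 * K₁ * (K₂ * |R|) * Torus.latNormSq 2 D := by
    calc ∫ ξ, ‖c₁ ξ‖ ^ 2 ≤ CL4 * Torus.latNormSq 1 (torusRep L fun y => boxInvLin L (w y - w' y)) * Torus.latNormSq 2 (torusRep L w) :=
          hCL4 _ _ (isSmooth_torusRep hMww') (isSmooth_torusRep hw)
      _ ≤ CL4 * (K₁ * Torus.latNormSq 1 D) * (K₂ * R) :=
          mul_le_mul (mul_le_mul_of_nonneg_left hrepMdiff hCL40) hrep2 (Torus.latNormSq_nonneg _ _) (by positivity)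
      _ ≤ CL4 * (K₁ * Torus.latNormSq 2 D) * (K₂ * R) :=
          mul_le_mul_of_nonneg_right (mul_le_mul_of_nonneg_left (mul_le_mul_of_nonneg_left hl12 hK₁0) hCL40) (by positivity)
      _ = _ := by rw [habs]; ring
  have hc₂b : ∫ ξ, ‖c₂ ξ‖ ^ 2 ≤ Csl * (CW2 * |R|) * K₁ * Torus.latNormSq 2 D := by
    have hW'eq : torusRep L (fun y => boxInvLin L (w' y)) = transportRep L hL hU' := rfl
    calc ∫ ξ, ‖c₂ ξ‖ ^ 2 ≤ Csl * Torus.latNormSq 2 (torusRep L fun y => boxInvLin L (w' y)) * Torus.latNormSq 1 (torusRep L fun y => w y - w' y) :=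
          hCsl _ _ (isSmooth_torusRep hMw') (isSmooth_torusRep hww')
      _ ≤ Csl * (CW2 * R) * (K₁ * Torus.latNormSq 1 D) := by
          rw [hW'eq]
          exact mul_le_mul (mul_le_mul_of_nonneg_left hW'2 hCsl0) hrep1 (Torus.latNormSq_nonneg _ _) (by positivity)
      _ ≤ Csl * (CW2 * R) * (K₁ * Torus.latNormSq 2 D) :=
          mul_le_mul_of_nonneg_left (mul_le_mul_of_nonneg_left hl12 hK₁0) (by positivity)
      _ = _ := by rw [habs]; ring
  rw [hlat0]
  calc Torus.latNormSq 0 (torusRep L fun x => pressureGrad hL hu x - pressureGrad hL hu' x)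
      ≤ C0 * ∫ x in (cylinderCell L : Set ℝ³), ‖pressureGrad hL hu x - pressureGrad hL hu' x‖ ^ 2 := hC0 _ hππ'
    _ ≤ C0 * (2 * (16 * L) * ((∫ ξ, ‖c₁ ξ‖ ^ 2) + ∫ ξ, ‖c₂ ξ‖ ^ 2)) := mul_le_mul_of_nonneg_left (hcellπ.trans hcellv) hC00
    _ ≤ C0 * (2 * (16 * L) * (CL4 * K₁ * (K₂ * |R|) * Torus.latNormSq 2 D + Csl * (CW2 * |R|) * K₁ * Torus.latNormSq 2 D)) :=
        mul_le_mul_of_nonneg_left (mul_le_mul_of_nonneg_left (add_le_add hc₁b hc₂b) (by positivity)) hC00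
    _ = _ := by ring

/-- **The local Lipschitz bound of Kato–Lai's operator in `L²` by the `H²` distance**: for `L > 0`
and `R` there is `C` with `∫ ‖klOp U − klOp U'‖² ≤ C lat₂(U − U')` whenever `lat₃ U, lat₃ U' ≤ R`.
[cite: KatoLai1984, §5 (weak continuity of `A`)] -/
theorem exists_lipschitz_klOp (R : ℝ) : ∃ C : ℝ, 0 ≤ C ∧
    ∀ (U U' : UnitAddTorus (Fin 3) → ℝ³) (hU : IsSmooth U) (hU' : IsSmooth U'),
      Torus.latNormSq 3 U ≤ R → Torus.latNormSq 3 U' ≤ R →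
      ∫ ξ, ‖klOp L hL hU ξ - klOp L hL hU' ξ‖ ^ 2 ≤ C * Torus.latNormSq 2 (fun ξ => U ξ - U' ξ) := by
  obtain ⟨Csl, hCsl0, hCsl⟩ := exists_integral_convect_sq_le_sup_left
  obtain ⟨CL4, hCL40, hCL4⟩ := exists_integral_convect_sq_le_L4
  obtain ⟨CW2, hCW20, hCW2⟩ := exists_latNormSq_transportRep_le hL (m := 2) (by norm_num)
  obtain ⟨K₁, hK₁0, hK₁⟩ := exists_latNormSq_one_lerayPart_sub_le hL
  obtain ⟨KG, hKG0, hKG⟩ := exists_integral_pressureRep_sub_sq_le hL R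
  refine ⟨4 * (CL4 * K₁ * |R| + Csl * CW2 * |R| + KG), by positivity, fun U U' hU hU' h3 h3' => ?_⟩
  have hR0 : 0 ≤ R := (Torus.latNormSq_nonneg 3 U).trans h3
  have habs : |R| = R := abs_of_nonneg hR0
  set D : UnitAddTorus (Fin 3) → ℝ³ := fun ξ => U ξ - U' ξ with hDdef
  have hD : IsSmooth D := hU.sub hU'
  have l1 := Torus.latNormSq_nonneg 1 D
  have l2 := Torus.latNormSq_nonneg 2 D
  have hl12 : Torus.latNormSq 1 D ≤ Torus.latNormSq 2 D := Torus.latNormSq_mono hD (by norm_num)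
  set W := transportRep L hL hU with hWdef
  set W' := transportRep L hL hU' with hW'def
  set G := pressureRep L hL hU with hGdef
  set G' := pressureRep L hL hU' with hG'def
  have hWs : IsSmooth W := isSmooth_transportRep hL hU
  have hW's : IsSmooth W' := isSmooth_transportRep hL hU'
  have hGs : IsSmooth G := isSmooth_pressureRep hL hU
  have hG's : IsSmooth G' := isSmooth_pressureRep hL hU'
  have hWWs : IsSmooth (fun ξ => W ξ - W' ξ) := hWs.sub hW's
  have hW1 := (hK₁ U U' hU hU').2
  have hW'2 : Torus.latNormSq 2 W' ≤ CW2 * R :=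
    (hCW2 U' hU').trans (mul_le_mul_of_nonneg_left ((Torus.latNormSq_mono hU' (by norm_num)).trans h3') hCW20)
  -- (a)
  have hTa : ∫ ξ, ‖Torus.convect (fun η => W η - W' η) U ξ‖ ^ 2 ≤ CL4 * K₁ * |R| * Torus.latNormSq 2 D := by
    have hl23 : Torus.latNormSq 2 U ≤ R := (Torus.latNormSq_mono hU (by norm_num)).trans h3
    calc _ ≤ CL4 * Torus.latNormSq 1 (fun ξ => W ξ - W' ξ) * Torus.latNormSq 2 U := hCL4 _ _ hWWs hU
      _ ≤ CL4 * (K₁ * Torus.latNormSq 1 D) * R := mul_le_mul (mul_le_mul_of_nonneg_left hW1 hCL40) hl23 (Torus.latNormSq_nonneg 2 U) (by positivity)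
      _ ≤ CL4 * (K₁ * Torus.latNormSq 2 D) * R :=
          mul_le_mul_of_nonneg_right (mul_le_mul_of_nonneg_left (mul_le_mul_of_nonneg_left hl12 hK₁0) hCL40) hR0
      _ = CL4 * K₁ * |R| * Torus.latNormSq 2 D := by rw [habs]; ring
  -- (b)
  have hTb : ∫ ξ, ‖Torus.convect W' D ξ‖ ^ 2 ≤ Csl * CW2 * |R| * Torus.latNormSq 2 D := by
    calc _ ≤ Csl * Torus.latNormSq 2 W' * Torus.latNormSq 1 D := hCsl _ _ hW's hD
      _ ≤ Csl * (CW2 * R) * Torus.latNormSq 2 D := mul_le_mul (mul_le_mul_of_nonneg_left hW'2 hCsl0) hl12 l1 (by positivity)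
      _ = Csl * CW2 * |R| * Torus.latNormSq 2 D := by rw [habs]; ring
  -- (c)
  have hTc : ∫ ξ, ‖G ξ - G' ξ‖ ^ 2 ≤ KG * Torus.latNormSq 2 D := hKG U U' hU hU' h3 h3'
  -- assembly
  have hpt : ∀ ξ, ‖klOp L hL hU ξ - klOp L hL hU' ξ‖ ^ 2 ≤
      4 * (‖Torus.convect (fun η => W η - W' η) U ξ‖ ^ 2 + ‖Torus.convect W' D ξ‖ ^ 2 + ‖G ξ - G' ξ‖ ^ 2) := by
    intro ξ
    have e : klOp L hL hU ξ - klOp L hL hU' ξ =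
        Torus.convect (fun η => W η - W' η) U ξ + Torus.convect W' D ξ - (G ξ - G' ξ) := by
      show (Torus.convect W U ξ - G ξ) - (Torus.convect W' U' ξ - G' ξ) = _
      rw [← convect_sub_convect hU hU' ξ]
      abel
    rw [e]
    exact norm_add_sub_sq_le_four _ _ _
  have hia : Integrable (fun ξ => ‖Torus.convect (fun η => W η - W' η) U ξ‖ ^ 2) volume := (hWWs.convect hU).norm_sq.integrable
  have hib : Integrable (fun ξ => ‖Torus.convect W' D ξ‖ ^ 2) volume := (hW's.convect hD).norm_sq.integrable
  have hic : Integrable (fun ξ => ‖G ξ - G' ξ‖ ^ 2) volume := (hGs.sub hG's).norm_sq.integrable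
  have hiab : Integrable (fun ξ => ‖Torus.convect (fun η => W η - W' η) U ξ‖ ^ 2 + ‖Torus.convect W' D ξ‖ ^ 2) volume := hia.add hib
  have hiabc : Integrable (fun ξ => ‖Torus.convect (fun η => W η - W' η) U ξ‖ ^ 2 + ‖Torus.convect W' D ξ‖ ^ 2 + ‖G ξ - G' ξ‖ ^ 2) volume :=
    hiab.add hic
  calc ∫ ξ, ‖klOp L hL hU ξ - klOp L hL hU' ξ‖ ^ 2
      ≤ ∫ ξ, 4 * (‖Torus.convect (fun η => W η - W' η) U ξ‖ ^ 2 + ‖Torus.convect W' D ξ‖ ^ 2 + ‖G ξ - G' ξ‖ ^ 2) :=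
        integral_mono_of_nonneg (ae_of_all _ fun ξ => sq_nonneg _) (hiabc.const_mul 4) (ae_of_all _ hpt)
    _ = 4 * (((∫ ξ, ‖Torus.convect (fun η => W η - W' η) U ξ‖ ^ 2) + (∫ ξ, ‖Torus.convect W' D ξ‖ ^ 2)) + ∫ ξ, ‖G ξ - G' ξ‖ ^ 2) := by
        rw [integral_const_mul, integral_add hiab hic, integral_add hia hib]
    _ ≤ 4 * (CL4 * K₁ * |R| * Torus.latNormSq 2 D + Csl * CW2 * |R| * Torus.latNormSq 2 D + KG * Torus.latNormSq 2 D) :=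
        mul_le_mul_of_nonneg_left (add_le_add (add_le_add hTa hTb) hTc) (by norm_num)
    _ = _ := by ring

end Lip

end PeriodicCylinder

end Literature.Analysis.FluidPDE
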